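import Mathlib.Analysis.SpecialFunctions.Complex.Arg
import Mathlib.Analysis.Complex.Convex
import Mathlib.Topology.Connected.LocallyConnected
import Mathlib.Topology.MetricSpace.HausdorffDistance
import Literature.Analysis.Complex.AnnulusCrossing
import HarnessLib

/-!
# Nested pockets of a conformal map: a target deep behind a small gate is conformally small

Topic: complex analysis / conformal maps of the upper half-plane (the geometric half of the
"hidden target" estimate in the two-point estimate for SLE). Let `f` be holomorphic and
injective on `ℍ` (think `f = f_ξ(· + W_ξ)`, the inverse Loewner map at a stopping time, so that
`f(0⁺)` is the tip of the curve), `z ∈ ℂ`, `r₀ > 0`, and suppose that a half-disc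
`{ζ ∈ ℍ : |ζ| < r⋆}` is mapped into `B(z, r₀)` (the tip is within `r₀` of `z`). For
`r > 0` let

* `V(r)` = the component of `ℍ ∩ f⁻¹(B(z, r))` containing that half-disc (the "tip component"),
* `W(r)` = the component of a fixed target point `q` in `ℍ ∖ closure V(r)` (the "pocket beyond
  level `r`"),

and consider the levels `r_k = r₀ 4^k`, `k = 0, …, K`. Suppose the target `T ⊆ ℍ` is connected,
contains `q`, has real boundary points (`closure T` meets `ℝ`), is mapped outside
`B̄(z, r_K)` — in the SLE application: the target (a separator segment) is at euclidean
distance `≥ r_K` from `z` while the tip is within `r₀` — and that **the pocket `W(r₀)` is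
bounded** (the one topological input: the target is enclosed, together with the tip side of
the boundary, by the gate; cf. Lawler–Werness (2013), Lemma 4.10, "there exists a crosscut …
that disconnects `I_ξ` from infinity", and Beffara (2008), Lemma 8 (i)). Then
(`Literature.Analysis.Complex.NestedPocket.subset_closedBall_of_nested`)

  `T ⊆ B̄(t, 4 e^{2C₁} q₁^{K-2} |t|)` for every `t ∈ T`,  `C₁ = 2π²/log (8/5)`,
  `q₁ = (e^{C₁} - 1)/(e^{C₁} + 1) < 1`:

**the target is exponentially small (in the number `K` of dyadic shells separating it from the
gate) compared with its distance from the tip `0`.** Combined with the one-point hitting bounds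
for SLE this gives `P[SLE from the tip reaches T] ≤ C q₁^{mK}`, the analogue of Lawler–Werness's
`c · exc(η, ξ)^β` (Lemma 4.5 with Lemma 4.4) and of Beffara's `P(σ̃ < ∞ | F_τ) ≤ C (δ/ρ)^η`
(Lemma 8 (i)) — here with no excursion measure, harmonic measure or extremal distance, only the
length–area inequality for concentric semicircles
(`AnnulusCrossing.lintegral_inv_le_of_forall_crossing`).

## Proof (nested arches)

All sets `W_k = W(r_k)` are bounded open and decrease in `k`; their real feet
`F_k = closure W_k ∩ ℝ` are nonempty compact and decrease; write `A_k = min F_k`,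
`B_k = max F_k`, `s_k = B_k - A_k`. A semicircle about a real point carrying a point of
`W_{k+1}` and a point of `closure V_k ∩ ℍ` carries (between them) a frontier point of `V_{k+1}`,
where `|f - z| ≥ r_{k+1} = 4 r_k`, so its image crosses the annulus `{5r_k/4 < |· - z| < 2r_k}`;
by the length–area inequality the radii of such semicircles about a fixed centre have
logarithmic measure `≤ C₁`. Three families of semicircles then give
* about `B_k` (radii between `B_k - B_{k+1}` and `B_k - A_{k+1}`): `B_k - B_{k+1} ≥ s_{k+1}/(e^{C₁}-1)`,
  and symmetrically on the left, whence `s_{k+1} ≤ q₁ s_k`;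
* about `A_{k+1}` (radii between `A_{k+1} - A_k` and the extent of `W_{k+1}`):
  `diam W_{k+1} ≤ 2 e^{C₁} s_k`;
* about `0` (radii between `dist(0, W_1)` and `sup_{W_1} |·|`, using that `W_1 ⊆ W_0` lies within
  the extent of `V_0 ∋ 0⁺`): `s_1 ≤ 2 sup_{W_1}|·| ≤ 2 e^{C₁} dist (0, W_1) ≤ 2 e^{C₁} dist(0, W_K)`.

## References

* G. F. Lawler, B. M. Werness, *Multi-point Green's functions for SLE and an estimate of Beffara*,
  Ann. Probab. 41 (2013), §4.1 (Lemmas 4.3–4.5) and Lemma 4.10. [LawlerWerness2010]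
* V. Beffara, *The dimension of the SLE curves*, Ann. Probab. 36 (2008), §3.1, Lemma 8 (i).
  [Beffara2008]
* Ch. Pommerenke, *Boundary Behaviour of Conformal Maps* (1992), Prop. 2.2 (length–area).
  [PommerenkeBBCM1992]
-/

noncomputable section

open Set Filter Metric Topology MeasureTheory Complex Real
open UpperHalfPlane (upperHalfPlaneSet isOpen_upperHalfPlaneSet)
open scoped ENNReal NNReal

namespace Literature.Analysis.Complex

namespace NestedPocket

open AnnulusCrossing

/-! ### Topological helpers -/

/-- A preconnected set meeting the closure of `A` and the closure of `Aᶜ` meets the frontier of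
`A`. [folklore] -/
theorem nonempty_inter_frontier {X : Type*} [TopologicalSpace X] {Q A : Set X}
    (hQ : IsPreconnected Q) (h1 : (Q ∩ closure A).Nonempty) (h2 : (Q ∩ closure Aᶜ).Nonempty) :
    (Q ∩ frontier A).Nonempty := by
  by_contra hcon
  rw [not_nonempty_iff_eq_empty] at hcon
  have hnofr : ∀ x ∈ Q, x ∉ frontier A := fun x hx hfr ↦ by
    have : x ∈ Q ∩ frontier A := ⟨hx, hfr⟩
    rw [hcon] at this
    exact this
  -- `Q ⊆ interior A ∪ interior Aᶜ`, two disjoint open sets both meeting `Q`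
  have hsplit : ∀ x ∈ Q, x ∈ closure A → x ∈ interior A := fun x hx hcl ↦ by
    by_contra h
    exact hnofr x hx ⟨hcl, h⟩
  have hsplit' : ∀ x ∈ Q, x ∈ closure Aᶜ → x ∈ interior Aᶜ := fun x hx hcl ↦ by
    by_contra h
    refine hnofr x hx ?_
    rw [← frontier_compl]
    exact ⟨hcl, h⟩
  have hsub : Q ⊆ interior A ∪ interior Aᶜ := by
    intro x hx
    by_cases h : x ∈ closure A
    · exact Or.inl (hsplit x hx h)
    · right
      apply hsplit' x hx
      rw [closure_compl]
      exact fun h' ↦ h (interior_subset_closure h' |> fun h'' ↦ subset_closure (interior_subset h'))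
  obtain ⟨a, haQ, ha⟩ := h1
  obtain ⟨b, hbQ, hb⟩ := h2
  have hdisj : interior A ∩ interior Aᶜ = ∅ := by
    ext x
    simp only [mem_inter_iff, mem_empty_iff_false, iff_false, not_and]
    intro h h'
    exact (interior_subset h') (interior_subset h)
  have := hQ _ _ isOpen_interior isOpen_interior hsub ⟨a, haQ, hsplit a haQ ha⟩
    ⟨b, hbQ, hsplit' b hbQ hb⟩
  rw [hdisj, inter_empty] at this
  exact this.ne_empty rfl

/-- In the plane, a point of an open set `O` lying in the closure of a component of `O` lies in
that component. [folklore] -/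
theorem mem_connectedComponentIn_of_mem_closure {O : Set ℂ} (hO : IsOpen O) {x q : ℂ} (hx : x ∈ O)
    (hcl : x ∈ closure (connectedComponentIn O q)) : x ∈ connectedComponentIn O q := by
  have hopen : IsOpen (connectedComponentIn O x) := hO.connectedComponentIn
  obtain ⟨w, hwx, hwq⟩ := mem_closure_iff.1 hcl _ hopen (mem_connectedComponentIn hx)
  rw [connectedComponentIn_eq hwq, ← connectedComponentIn_eq hwx]
  exact mem_connectedComponentIn hx

/-- If `x` is in the closure of a component of the open set `O` but not in the component, then
`x ∉ O`. [folklore] -/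
theorem notMem_of_mem_closure_diff {O : Set ℂ} (hO : IsOpen O) {x q : ℂ}
    (hcl : x ∈ closure (connectedComponentIn O q)) (hx : x ∉ connectedComponentIn O q) : x ∉ O :=
  fun h ↦ hx (mem_connectedComponentIn_of_mem_closure hO h hcl)

/-- A point of `ℍ` at distance `u` from the real point `c` is `c + u e^{iθ}` with `0 < θ < π`.
[folklore] -/
theorem exists_circleMap_eq {c u : ℝ} {a : ℂ} (ha : 0 < a.im) (hu : dist a c = u) :
    ∃ θ ∈ Ioo (0 : ℝ) π, circleMap (c : ℂ) u θ = a := by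
  set w : ℂ := a - c with hw
  have hwim : 0 < w.im := by simpa [hw] using ha
  have hθ : arg w ∈ Ioo 0 π := by
    refine ⟨?_, ?_⟩
    · rcases (Complex.arg_nonneg_iff.2 hwim.le).eq_or_lt with h | h
      · exact absurd (Complex.arg_eq_zero_iff.1 h.symm).2 hwim.ne'
      · exact h
    · rcases (Complex.arg_le_pi w).eq_or_lt with h | h
      · exact absurd (Complex.arg_eq_pi_iff.1 h).2 hwim.ne'
      · exact h
  refine ⟨arg w, hθ, ?_⟩
  have hnorm : ‖w‖ = u := by rw [← hu, dist_eq_norm]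
  rw [circleMap, ← hnorm]
  have := Complex.norm_mul_exp_arg_mul_I w
  rw [this, hw]
  ring

/-- **Intermediate radii are hit**: a preconnected subset of `ℍ` containing points at distance
`< u` and `> u` from the real point `c` meets the open upper semicircle of radius `u` about `c`.
[folklore] -/
theorem exists_circleMap_mem {A : Set ℂ} (hA : IsPreconnected A) (hAH : A ⊆ upperHalfPlaneSet)
    {c u : ℝ} {a b : ℂ} (ha : a ∈ A) (hb : b ∈ A) (hau : dist a c < u) (hub : u < dist b c) :
    ∃ θ ∈ Ioo (0 : ℝ) π, circleMap (c : ℂ) u θ ∈ A := by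
  have hcont : Continuous fun x : ℂ ↦ dist x c := continuous_id.dist continuous_const
  obtain ⟨x, hxA, hx⟩ := hA.intermediate_value ha hb hcont.continuousOn ⟨hau.le, hub.le⟩
  obtain ⟨θ, hθ, hθx⟩ := exists_circleMap_eq (hAH hxA) hx
  exact ⟨θ, hθ, hθx ▸ hxA⟩

/-- The same with `a` only in the closure of `A`. [folklore] -/
theorem exists_circleMap_mem_of_closure_left {A : Set ℂ} (hA : IsPreconnected A)
    (hAH : A ⊆ upperHalfPlaneSet) {c u : ℝ} {a b : ℂ} (ha : a ∈ closure A) (hb : b ∈ A)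
    (hau : dist a c < u) (hub : u < dist b c) :
    ∃ θ ∈ Ioo (0 : ℝ) π, circleMap (c : ℂ) u θ ∈ A := by
  have hcont : Continuous fun x : ℂ ↦ dist x c := continuous_id.dist continuous_const
  have hopen : IsOpen {x : ℂ | dist x c < u} := isOpen_lt hcont continuous_const
  obtain ⟨a', ha'⟩ := mem_closure_iff.1 ha _ hopen hau
  exact exists_circleMap_mem hA hAH ha'.2 hb ha'.1 hub

/-- The same with `b` only in the closure of `A`. [folklore] -/
theorem exists_circleMap_mem_of_closure_right {A : Set ℂ} (hA : IsPreconnected A)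
    (hAH : A ⊆ upperHalfPlaneSet) {c u : ℝ} {a b : ℂ} (ha : a ∈ A) (hb : b ∈ closure A)
    (hau : dist a c < u) (hub : u < dist b c) :
    ∃ θ ∈ Ioo (0 : ℝ) π, circleMap (c : ℂ) u θ ∈ A := by
  have hcont : Continuous fun x : ℂ ↦ dist x c := continuous_id.dist continuous_const
  have hopen : IsOpen {x : ℂ | u < dist x c} := isOpen_lt continuous_const hcont
  obtain ⟨b', hb'⟩ := mem_closure_iff.1 hb _ hopen hub
  exact exists_circleMap_mem hA hAH ha hb'.2 hau hb'.1

/-- The same with both points only in the closure of `A`. [folklore] -/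
theorem exists_circleMap_mem_of_closure {A : Set ℂ} (hA : IsPreconnected A)
    (hAH : A ⊆ upperHalfPlaneSet) {c u : ℝ} {a b : ℂ} (ha : a ∈ closure A) (hb : b ∈ closure A)
    (hau : dist a c < u) (hub : u < dist b c) :
    ∃ θ ∈ Ioo (0 : ℝ) π, circleMap (c : ℂ) u θ ∈ A := by
  have hcont : Continuous fun x : ℂ ↦ dist x c := continuous_id.dist continuous_const
  have hopen : IsOpen {x : ℂ | dist x c < u} := isOpen_lt hcont continuous_const
  obtain ⟨a', ha'⟩ := mem_closure_iff.1 ha _ hopen hau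
  exact exists_circleMap_mem_of_closure_right hA hAH ha'.2 hb ha'.1 hub

/-! ### The logarithmic measure of crossing radii -/

/-- The constant `C₁ = 2π² / log (8/5)` bounding the logarithmic measure of a family of
concentric semicircles all crossing an annulus of modulus `log (8/5)`. [folklore] -/
def logConst : ℝ := 2 * π ^ 2 / Real.log (8 / 5)

/-- `C₁ > 0`. [folklore] -/
theorem logConst_pos : 0 < logConst := by
  unfold logConst
  have : 0 < Real.log (8 / 5) := Real.log_pos (by norm_num)
  positivity

/-- `∫_0^{b} du/u = ∞` for `b > 0`. [folklore] -/
theorem lintegral_inv_Ioo_zero {b : ℝ} (hb : 0 < b) :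
    ∫⁻ u in Ioo (0 : ℝ) b, ENNReal.ofReal u⁻¹ = ∞ := by
  refine eq_top_iff.2 (le_of_forall_lt fun M hM ↦ ?_)
  have hMtop : M ≠ ∞ := hM.ne
  set m : ℝ := M.toReal with hm
  have hm0 : 0 ≤ m := ENNReal.toReal_nonneg
  set ε : ℝ := b * Real.exp (-(m + 1)) with hε
  have hε0 : 0 < ε := by positivity
  have hεu : ε < b := by
    have : Real.exp (-(m + 1)) < 1 := Real.exp_lt_one_iff.2 (by linarith)
    rw [hε]; nlinarith
  have hlog : Real.log (b / ε) = m + 1 := by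
    have : b / ε = Real.exp (m + 1) := by
      rw [hε, Real.exp_neg]
      field_simp
    rw [this, Real.log_exp]
  calc M = ENNReal.ofReal m := (ENNReal.ofReal_toReal hMtop).symm
    _ < ENNReal.ofReal (m + 1) := by
        rw [ENNReal.ofReal_lt_ofReal_iff_of_nonneg hm0]; linarith
    _ = ∫⁻ u in Ioo ε b, ENNReal.ofReal u⁻¹ := by rw [lintegral_inv_Ioo hε0 hεu.le, hlog]
    _ ≤ ∫⁻ u in Ioo 0 b, ENNReal.ofReal u⁻¹ := lintegral_mono_set (Ioo_subset_Ioo hε0.le le_rfl)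

/-- **Ratio bound from crossings.** If `f - z` is holomorphic and injective on `ℍ` and for every
radius `u ∈ (u₁, u₂)` (`0 ≤ u₁`) the upper semicircle of radius `u` about the real point `c`
carries a point mapped into `B̄(z, r)` and a point mapped outside `B(z, 4r)`, then
`u₂ ≤ e^{C₁} u₁`. [cite: PommerenkeBBCM1992, Prop. 2.2] -/
theorem le_exp_mul_of_forall_crossing {f : ℂ → ℂ} (hf : DifferentiableOn ℂ f upperHalfPlaneSet)
    (hinj : InjOn f upperHalfPlaneSet) {z : ℂ} {r : ℝ} (hr : 0 < r) {c u₁ u₂ : ℝ} (hu₁ : 0 ≤ u₁)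
    (hcross : ∀ u ∈ Ioo u₁ u₂, ∃ θ' ∈ Ioo (0 : ℝ) π, ∃ θ'' ∈ Ioo (0 : ℝ) π,
      ‖f (circleMap (c : ℂ) u θ') - z‖ ≤ r ∧ 4 * r ≤ ‖f (circleMap (c : ℂ) u θ'') - z‖) :
    u₂ ≤ Real.exp logConst * u₁ := by
  by_contra hcon
  rw [not_le] at hcon
  have hu₂ : 0 < u₂ := lt_of_le_of_lt (by positivity) hcon
  set F : ℂ → ℂ := fun w ↦ f w - z with hF
  have hFd : DifferentiableOn ℂ F upperHalfPlaneSet := hf.sub_const z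
  have hFinj : InjOn F upperHalfPlaneSet := fun x hx y hy h ↦ hinj hx hy (sub_left_injective h)
  have hcross' : ∀ u ∈ Ioo u₁ u₂, ∃ θ' ∈ Ioo (0 : ℝ) π, ∃ θ'' ∈ Ioo (0 : ℝ) π,
      ‖F (circleMap (c : ℂ) u θ')‖ < 5 / 4 * r ∧ 2 * r < ‖F (circleMap (c : ℂ) u θ'')‖ := by
    intro u hu
    obtain ⟨θ', hθ', θ'', hθ'', h1, h2⟩ := hcross u hu
    exact ⟨θ', hθ', θ'', hθ'', by simp only [hF]; linarith, by simp only [hF]; linarith⟩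
  have hmod : Real.log (2 * r / (5 / 4 * r)) = Real.log (8 / 5) := by
    congr 1; field_simp; norm_num
  rcases hu₁.eq_or_lt with h0 | h0
  · -- `u₁ = 0`: the logarithmic measure of `(0, u₂)` is infinite
    have h := lintegral_inv_le_of_forall_crossing (c := c) hFd hFinj
      (by positivity : (0 : ℝ) < 5 / 4 * r) (by linarith : 5 / 4 * r < 2 * r) measurableSet_Ioo
      (fun u hu ↦ (h0.le.trans_lt hu.1 : (0 : ℝ) < u)) hcross'
    rw [← h0, lintegral_inv_Ioo_zero hu₂] at h
    exact absurd h (by simp)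
  · have h := lintegral_inv_le_of_forall_crossing (c := c) hFd hFinj
      (by positivity : (0 : ℝ) < 5 / 4 * r) (by linarith : 5 / 4 * r < 2 * r) measurableSet_Ioo
      (fun u hu ↦ h0.trans hu.1) hcross'
    have hu12 : u₁ ≤ u₂ := by
      have : u₁ ≤ Real.exp logConst * u₁ := le_mul_of_one_le_left hu₁ (Real.one_le_exp logConst_pos.le)
      linarith
    rw [lintegral_inv_Ioo h0 hu12, hmod] at h
    change ENNReal.ofReal (Real.log (u₂ / u₁)) ≤ ENNReal.ofReal logConst at h
    rw [ENNReal.ofReal_le_ofReal_iff logConst_pos.le] at h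
    have h2 : u₂ / u₁ ≤ Real.exp logConst := by
      rw [← Real.log_le_iff_le_exp (div_pos hu₂ h0)]
      exact h
    rw [div_le_iff₀ h0] at h2
    linarith

/-! ### The setup: tip components and pockets -/

variable (f : ℂ → ℂ) (z : ℂ) (rstar : ℝ)

/-- `ℍ ∩ f⁻¹(B(z, r))`. [folklore] -/
def preS (r : ℝ) : Set ℂ := upperHalfPlaneSet ∩ f ⁻¹' ball z r

/-- The base point `i r⋆/2` of the tip components. [folklore] -/
def basePoint : ℂ := ((rstar / 2 : ℝ) : ℂ) * I

/-- **The tip component** `V(r)`: the component of `ℍ ∩ f⁻¹(B(z, r))` containing the point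
`i r⋆/2` (and with it the half-disc `{|ζ| < r⋆} ∩ ℍ`, mapped into `B(z, r₀) ⊆ B(z, r)`).
[cite: LawlerWerness2010, Lemma 4.10 (the gate crosscut)] -/
def tipComp (r : ℝ) : Set ℂ := connectedComponentIn (preS f z r) (basePoint rstar)

/-- **The pocket beyond level `r`**: the component of `q` in `ℍ ∖ closure V(r)`.
[cite: LawlerWerness2010, Lemma 4.10] -/
def pocket (r : ℝ) (q : ℂ) : Set ℂ :=
  connectedComponentIn (upperHalfPlaneSet \ closure (tipComp f z rstar r)) q

/-- The real feet `F(r) = closure W(r) ∩ ℝ` of a pocket. [folklore] -/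
def feet (r : ℝ) (q : ℂ) : Set ℂ := closure (pocket f z rstar r q) ∩ {x | x.im = 0}

variable {f z rstar} {r₀ : ℝ}

section Basic

/-- The base point `i r⋆/2` is in `ℍ` and has norm `< r⋆` (`r⋆ > 0`). [folklore] -/
theorem basePoint_mem (hrstar : 0 < rstar) : basePoint rstar ∈ upperHalfPlaneSet ∧
    ‖basePoint rstar‖ < rstar := by
  refine ⟨?_, ?_⟩
  · show 0 < (basePoint rstar).im
    simp [basePoint]; positivity
  · rw [basePoint, norm_mul, Complex.norm_real, Complex.norm_I, mul_one, Real.norm_eq_abs,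
      abs_of_pos (by positivity)]
    linarith

/-- The half-disc `{|ζ| < r⋆} ∩ ℍ` lies in every tip component `V(r)`, `r ≥ r₀`. [folklore] -/
theorem halfDisc_subset_tipComp (hrstar : 0 < rstar)
    (h0 : ∀ ζ ∈ upperHalfPlaneSet, ‖ζ‖ < rstar → ‖f ζ - z‖ < r₀) {r : ℝ} (hr : r₀ ≤ r) :
    upperHalfPlaneSet ∩ ball (0 : ℂ) rstar ⊆ tipComp f z rstar r := by
  have hsub : upperHalfPlaneSet ∩ ball (0 : ℂ) rstar ⊆ preS f z r := by
    rintro ζ ⟨hζ, hζb⟩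
    refine ⟨hζ, ?_⟩
    show f ζ ∈ ball z r
    rw [mem_ball, dist_eq_norm]
    rw [mem_ball, dist_zero_right] at hζb
    exact (h0 ζ hζ hζb).trans_le hr
  have hconn : IsPreconnected (upperHalfPlaneSet ∩ ball (0 : ℂ) rstar) :=
    ((convex_halfSpace_im_gt 0).inter (convex_ball _ _)).isPreconnected
  have hmem : basePoint rstar ∈ upperHalfPlaneSet ∩ ball (0 : ℂ) rstar :=
    ⟨(basePoint_mem hrstar).1, by rw [mem_ball, dist_zero_right]; exact (basePoint_mem hrstar).2⟩
  exact hconn.subset_connectedComponentIn hmem hsub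

/-- `0 ∈ closure V(r)` for `r ≥ r₀`. [folklore] -/
theorem zero_mem_closure_tipComp (hrstar : 0 < rstar)
    (h0 : ∀ ζ ∈ upperHalfPlaneSet, ‖ζ‖ < rstar → ‖f ζ - z‖ < r₀) {r : ℝ} (hr : r₀ ≤ r) :
    (0 : ℂ) ∈ closure (tipComp f z rstar r) := by
  refine closure_mono (halfDisc_subset_tipComp hrstar h0 hr) ?_
  rw [Metric.mem_closure_iff]
  intro ε hε
  set δ : ℝ := min (ε / 2) (rstar / 2) with hδ
  have hδ0 : 0 < δ := by positivity
  refine ⟨((δ : ℝ) : ℂ) * I, ⟨?_, ?_⟩, ?_⟩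
  · show 0 < ((((δ : ℝ) : ℂ) * I)).im
    simp; positivity
  · rw [mem_ball, dist_zero_right, norm_mul, Complex.norm_real, Complex.norm_I, mul_one,
      Real.norm_eq_abs, abs_of_pos hδ0]
    exact (min_le_right _ _).trans_lt (by linarith)
  · rw [dist_comm, dist_zero_right, norm_mul, Complex.norm_real, Complex.norm_I, mul_one,
      Real.norm_eq_abs, abs_of_pos hδ0]
    exact (min_le_left _ _).trans_lt (by linarith)

/-- `V` is monotone in the level. [folklore] -/
theorem tipComp_mono {r r' : ℝ} (h : r ≤ r') : tipComp f z rstar r ⊆ tipComp f z rstar r' :=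
  connectedComponentIn_mono _ (inter_subset_inter_right _ (preimage_mono (ball_subset_ball h)))

/-- `W` is antitone in the level. [folklore] -/
theorem pocket_anti {r r' : ℝ} (h : r ≤ r') (q : ℂ) : pocket f z rstar r' q ⊆ pocket f z rstar r q :=
  connectedComponentIn_mono _ fun _ hx ↦ ⟨hx.1, fun hx' ↦ hx.2 (closure_mono (tipComp_mono h) hx')⟩

/-- Feet are antitone in the level. [folklore] -/
theorem feet_anti {r r' : ℝ} (h : r ≤ r') (q : ℂ) : feet f z rstar r' q ⊆ feet f z rstar r q :=
  inter_subset_inter_left _ (closure_mono (pocket_anti h q))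

/-- `V(r)` is open. [folklore] -/
theorem isOpen_tipComp (hf : DifferentiableOn ℂ f upperHalfPlaneSet) (r : ℝ) :
    IsOpen (tipComp f z rstar r) := by
  have : IsOpen (preS f z r) :=
    hf.continuousOn.isOpen_inter_preimage isOpen_upperHalfPlaneSet isOpen_ball
  exact this.connectedComponentIn

/-- `ℍ ∖ closure V(r)` is open. [folklore] -/
theorem isOpen_compl_closure (r : ℝ) : IsOpen (upperHalfPlaneSet \ closure (tipComp f z rstar r)) :=
  isOpen_upperHalfPlaneSet.sdiff isClosed_closure

/-- `W(r)` is open. [folklore] -/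
theorem isOpen_pocket (r : ℝ) (q : ℂ) : IsOpen (pocket f z rstar r q) :=
  (isOpen_compl_closure r).connectedComponentIn

/-- `W(r) ⊆ ℍ`. [folklore] -/
theorem pocket_subset (r : ℝ) (q : ℂ) : pocket f z rstar r q ⊆ upperHalfPlaneSet :=
  fun _ hx ↦ (connectedComponentIn_subset _ _ hx).1

/-- `W(r)` is preconnected. [folklore] -/
theorem isPreconnected_pocket (r : ℝ) (q : ℂ) : IsPreconnected (pocket f z rstar r q) :=
  isPreconnected_connectedComponentIn

/-- Points of `ℍ` in the closure of `V(r)` are mapped into the closed ball `B̄(z, r)`.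
[folklore] -/
theorem norm_sub_le_of_mem_closure_tipComp (hf : DifferentiableOn ℂ f upperHalfPlaneSet) {r : ℝ}
    {x : ℂ} (hx : x ∈ upperHalfPlaneSet) (hcl : x ∈ closure (tipComp f z rstar r)) :
    ‖f x - z‖ ≤ r := by
  have hcont : ContinuousAt f x := hf.continuousOn.continuousAt (isOpen_upperHalfPlaneSet.mem_nhds hx)
  rw [mem_closure_iff_seq_limit] at hcl
  obtain ⟨s, hs, hsx⟩ := hcl
  have hlim : Tendsto (fun n ↦ ‖f (s n) - z‖) atTop (𝓝 ‖f x - z‖) :=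
    ((hcont.tendsto.comp hsx).sub tendsto_const_nhds).norm
  refine le_of_tendsto hlim (Eventually.of_forall fun n ↦ ?_)
  have h1 : s n ∈ preS f z r := connectedComponentIn_subset _ _ (hs n)
  have h2 : f (s n) ∈ ball z r := h1.2
  rw [mem_ball, dist_eq_norm] at h2
  exact h2.le

/-- **Frontier points of the tip component are mapped outside the open ball**: if `x ∈ ℍ` is in
`closure V(r) ∖ V(r)` then `|f x - z| ≥ r`. [folklore] -/
theorem le_norm_sub_of_mem_frontier_tipComp (hf : DifferentiableOn ℂ f upperHalfPlaneSet) {r : ℝ}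
    {x : ℂ} (hx : x ∈ upperHalfPlaneSet) (hcl : x ∈ closure (tipComp f z rstar r))
    (hnot : x ∉ tipComp f z rstar r) : r ≤ ‖f x - z‖ := by
  have hO : IsOpen (preS f z r) :=
    hf.continuousOn.isOpen_inter_preimage isOpen_upperHalfPlaneSet isOpen_ball
  have hxS : x ∉ preS f z r := notMem_of_mem_closure_diff hO hcl hnot
  by_contra h
  rw [not_le] at h
  exact hxS ⟨hx, by rw [mem_preimage, mem_ball, dist_eq_norm]; exact h⟩

/-- **Frontier points of a pocket inside `ℍ` lie in the closure of the tip component.**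
[folklore] -/
theorem mem_closure_tipComp_of_mem_frontier_pocket {r : ℝ} {q x : ℂ} (hx : x ∈ upperHalfPlaneSet)
    (hcl : x ∈ closure (pocket f z rstar r q)) (hnot : x ∉ pocket f z rstar r q) :
    x ∈ closure (tipComp f z rstar r) := by
  have h := notMem_of_mem_closure_diff (isOpen_compl_closure r) hcl hnot
  by_contra hcon
  exact h ⟨hx, hcon⟩

/-- A preconnected subset of `ℍ` missing `closure V(r)` and meeting the pocket `W(r)` of `q`
lies in that pocket. [folklore] -/
theorem subset_pocket_of_isPreconnected {r : ℝ} {q : ℂ} {T : Set ℂ} (hT : IsPreconnected T)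
    (hTH : T ⊆ upperHalfPlaneSet) (hTV : Disjoint T (closure (tipComp f z rstar r)))
    (hq : q ∈ T) : T ⊆ pocket f z rstar r q :=
  hT.subset_connectedComponentIn hq fun _ ht ↦ ⟨hTH ht, fun h ↦ hTV.ne_of_mem ht h rfl⟩

end Basic

/-! ### The crossing produced by a semicircle through a pocket and the closure of a tip component -/

section Crossing

/-- **A semicircle carrying a point of the pocket `W(r')` and a point of `closure V(r) ∩ ℍ`
(`r ≤ r'`) carries a point mapped into `B̄(z, r)` and a point mapped outside `B(z, r')`** (between
them lies a frontier point of `V(r')`). [folklore] -/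
theorem exists_crossing_of_mem (hf : DifferentiableOn ℂ f upperHalfPlaneSet) {r r' : ℝ}
    (hrr' : r ≤ r') {q : ℂ} {c u : ℝ} {θW θV : ℝ} (hθW : θW ∈ Ioo (0 : ℝ) π)
    (hθV : θV ∈ Ioo (0 : ℝ) π) (hW : circleMap (c : ℂ) u θW ∈ pocket f z rstar r' q)
    (hV : circleMap (c : ℂ) u θV ∈ closure (tipComp f z rstar r)) (hu : 0 < u) :
    ∃ θ' ∈ Ioo (0 : ℝ) π, ∃ θ'' ∈ Ioo (0 : ℝ) π,
      ‖f (circleMap (c : ℂ) u θ') - z‖ ≤ r ∧ r' ≤ ‖f (circleMap (c : ℂ) u θ'') - z‖ := by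
  -- the inner point
  have hVin : circleMap (c : ℂ) u θV ∈ upperHalfPlaneSet := circleMap_mem_upperHalfPlaneSet c hu hθV
  have h1 : ‖f (circleMap (c : ℂ) u θV) - z‖ ≤ r := norm_sub_le_of_mem_closure_tipComp hf hVin hV
  -- the arc between `θW` and `θV`
  set Q : Set ℂ := circleMap (c : ℂ) u '' uIcc θW θV with hQ
  have hQconn : IsPreconnected Q :=
    isPreconnected_uIcc.image _ (continuous_circleMap _ _).continuousOn
  set V' : Set ℂ := tipComp f z rstar r' with hV'
  have hVcl : circleMap (c : ℂ) u θV ∈ closure V' := closure_mono (tipComp_mono hrr') hV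
  have hWout : circleMap (c : ℂ) u θW ∈ closure V'ᶜ := by
    refine subset_closure ?_
    intro hmem
    have hW' : circleMap (c : ℂ) u θW ∈ upperHalfPlaneSet \ closure V' :=
      connectedComponentIn_subset _ _ hW
    exact hW'.2 (subset_closure hmem)
  obtain ⟨x, hxQ, hxfr⟩ := nonempty_inter_frontier (A := V') hQconn
    ⟨_, ⟨θV, right_mem_uIcc, rfl⟩, hVcl⟩ ⟨_, ⟨θW, left_mem_uIcc, rfl⟩, hWout⟩
  obtain ⟨θ, hθ, rfl⟩ := hxQ
  have hθI : θ ∈ Ioo (0 : ℝ) π := by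
    rcases le_total θW θV with h | h
    · rw [uIcc_of_le h] at hθ; exact ⟨hθW.1.trans_le hθ.1, hθ.2.trans_lt hθV.2⟩
    · rw [uIcc_of_ge h] at hθ; exact ⟨hθV.1.trans_le hθ.1, hθ.2.trans_lt hθW.2⟩
  have hxin : circleMap (c : ℂ) u θ ∈ upperHalfPlaneSet := circleMap_mem_upperHalfPlaneSet c hu hθI
  have hopen : IsOpen V' := isOpen_tipComp hf r'
  have hxcl : circleMap (c : ℂ) u θ ∈ closure V' := frontier_subset_closure hxfr
  have hnotV : circleMap (c : ℂ) u θ ∉ V' := by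
    intro h
    have : circleMap (c : ℂ) u θ ∈ interior V' := hopen.interior_eq.symm ▸ h
    exact hxfr.2 this
  exact ⟨θV, hθV, θ, hθI, h1, le_norm_sub_of_mem_frontier_tipComp hf hxin hxcl hnotV⟩

/-- **A semicircle about a real centre carrying a point of a sub-pocket `W(r') ⊆ W(r)` and ending
outside `closure W(r)` carries a point of `closure V(r) ∩ ℍ`**: if `circleMap c u θW ∈ W(r')`
(`r ≤ r'`) and an end point `c + u` or `c - u` of the semicircle is not in `closure W(r)`, then
some `circleMap c u θ`, `θ ∈ (0, π)`, lies in `closure V(r)`. [folklore] -/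
theorem exists_mem_closure_tipComp_of_endpoint {r r' : ℝ} (hrr' : r ≤ r') {q : ℂ} {c u : ℝ}
    (hu : 0 < u) {θW : ℝ} (hθW : θW ∈ Ioo (0 : ℝ) π)
    (hW : circleMap (c : ℂ) u θW ∈ pocket f z rstar r' q) {e : ℝ} (he : e = 0 ∨ e = π)
    (hend : circleMap (c : ℂ) u e ∉ closure (pocket f z rstar r q)) :
    ∃ θ ∈ Ioo (0 : ℝ) π, circleMap (c : ℂ) u θ ∈ closure (tipComp f z rstar r) := by
  set W : Set ℂ := pocket f z rstar r q with hWdef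
  have hWin : circleMap (c : ℂ) u θW ∈ W := pocket_anti hrr' q hW
  -- a parameter `e'` strictly inside `(0, π)`, near `e`, still outside `closure W`
  have hopen : IsOpen ((closure W)ᶜ) := isClosed_closure.isOpen_compl
  have hcont : Continuous fun θ : ℝ ↦ circleMap (c : ℂ) u θ := continuous_circleMap _ _
  have hpre : IsOpen ((fun θ : ℝ ↦ circleMap (c : ℂ) u θ) ⁻¹' (closure W)ᶜ) := hopen.preimage hcont
  obtain ⟨δ, hδ, hδsub⟩ := Metric.isOpen_iff.1 hpre e hend
  -- the point at parameter `e' = δ/2` or `π - δ/2` (clipped into `(0, π)` and towards `θW`)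
  obtain ⟨e', he'I, he'out⟩ : ∃ e' ∈ Ioo (0 : ℝ) π, circleMap (c : ℂ) u e' ∉ closure W := by
    rcases he with rfl | rfl
    · refine ⟨min (δ / 2) θW, ⟨lt_min (by positivity) hθW.1, (min_le_right _ _).trans_lt hθW.2⟩, ?_⟩
      have : min (δ / 2) θW ∈ ball (0 : ℝ) δ := by
        rw [mem_ball, dist_zero_right, Real.norm_eq_abs, abs_of_pos (lt_min (by positivity) hθW.1)]
        exact (min_le_left _ _).trans_lt (by linarith)
      exact hδsub this
    · refine ⟨max (π - δ / 2) θW, ⟨hθW.1.trans_le (le_max_right _ _),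
        max_lt (by linarith) hθW.2⟩, ?_⟩
      have : max (π - δ / 2) θW ∈ ball π δ := by
        rw [mem_ball, Real.dist_eq, abs_lt]
        constructor
        · have := le_max_left (π - δ / 2) θW; linarith
        · have := max_lt (by linarith : π - δ / 2 < π) hθW.2; linarith
      exact hδsub this
  -- the arc from `e'` to `θW` meets the frontier of `W`
  set Q : Set ℂ := circleMap (c : ℂ) u '' uIcc e' θW with hQ
  have hQconn : IsPreconnected Q := isPreconnected_uIcc.image _ hcont.continuousOn
  obtain ⟨x, hxQ, hxfr⟩ := nonempty_inter_frontier (A := W) hQconn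
    ⟨_, ⟨θW, right_mem_uIcc, rfl⟩, subset_closure hWin⟩
    ⟨_, ⟨e', left_mem_uIcc, rfl⟩, subset_closure fun h ↦ he'out (subset_closure h)⟩
  obtain ⟨θ, hθ, rfl⟩ := hxQ
  have hθI : θ ∈ Ioo (0 : ℝ) π := by
    rcases le_total e' θW with h | h
    · rw [uIcc_of_le h] at hθ; exact ⟨he'I.1.trans_le hθ.1, hθ.2.trans_lt hθW.2⟩
    · rw [uIcc_of_ge h] at hθ; exact ⟨hθW.1.trans_le hθ.1, hθ.2.trans_lt he'I.2⟩
  have hxin : circleMap (c : ℂ) u θ ∈ upperHalfPlaneSet := circleMap_mem_upperHalfPlaneSet c hu hθI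
  have hxcl : circleMap (c : ℂ) u θ ∈ closure W := frontier_subset_closure hxfr
  have hnotW : circleMap (c : ℂ) u θ ∉ W := by
    intro h
    have : circleMap (c : ℂ) u θ ∈ interior W := (isOpen_pocket r q).interior_eq.symm ▸ h
    exact hxfr.2 this
  exact ⟨θ, hθI, mem_closure_tipComp_of_mem_frontier_pocket hxin hxcl hnotW⟩

end Crossing

/-! ### The main estimate -/

/-- The levels `r_k = r₀ 4^k`. [folklore] -/
def level (r₀ : ℝ) (k : ℕ) : ℝ := r₀ * 4 ^ k

/-- `r_k > 0`. [folklore] -/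
theorem level_pos (hr₀ : 0 < r₀) (k : ℕ) : 0 < level r₀ k := by unfold level; positivity

/-- `r_k ≤ r_{k'}` for `k ≤ k'`. [folklore] -/
theorem level_mono (hr₀ : 0 ≤ r₀) {k k' : ℕ} (h : k ≤ k') : level r₀ k ≤ level r₀ k' := by
  unfold level
  exact mul_le_mul_of_nonneg_left (pow_le_pow_right₀ (by norm_num) h) hr₀

/-- `r_0 = r₀`. [folklore] -/
theorem level_zero : level r₀ 0 = r₀ := by unfold level; simp

/-- `r_{k+1} = 4 r_k`. [folklore] -/
theorem level_succ (k : ℕ) : level r₀ (k + 1) = 4 * level r₀ k := by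
  unfold level; rw [pow_succ]; ring

section Main

variable (hf : DifferentiableOn ℂ f upperHalfPlaneSet) (hinj : InjOn f upperHalfPlaneSet)
  (hr₀ : 0 < r₀)

include hf hinj hr₀ in
/-- **Ratio bound between consecutive levels.** If for every `u ∈ (u₁, u₂)` (`0 ≤ u₁`) the
semicircle of radius `u` about the real point `c` carries a point of `W(r_{k+1})` and a point of
`closure V(r_k)` (at angles in `(0, π)`), then `u₂ ≤ e^{C₁} u₁`.
[cite: PommerenkeBBCM1992, Prop. 2.2] -/
theorem ratio_le {k : ℕ} {q : ℂ} {c u₁ u₂ : ℝ} (hu₁ : 0 ≤ u₁)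
    (hmeet : ∀ u ∈ Ioo u₁ u₂, ∃ θW ∈ Ioo (0 : ℝ) π, ∃ θV ∈ Ioo (0 : ℝ) π,
      circleMap (c : ℂ) u θW ∈ pocket f z rstar (level r₀ (k + 1)) q ∧
      circleMap (c : ℂ) u θV ∈ closure (tipComp f z rstar (level r₀ k))) :
    u₂ ≤ Real.exp logConst * u₁ := by
  refine le_exp_mul_of_forall_crossing (z := z) (c := c) hf hinj (level_pos hr₀ k) hu₁ fun u hu ↦ ?_
  obtain ⟨θW, hθW, θV, hθV, hW, hV⟩ := hmeet u hu
  have hu0 : 0 < u := hu₁.trans_lt hu.1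
  obtain ⟨θ', hθ', θ'', hθ'', h1, h2⟩ := exists_crossing_of_mem hf
    (level_mono hr₀.le (Nat.le_succ k)) hθW hθV hW hV hu0
  refine ⟨θ', hθ', θ'', hθ'', h1, ?_⟩
  rwa [level_succ] at h2


/-! ### Auxiliary: extreme feet, the outer region -/

omit hf hinj hr₀ in
/-- The leftmost and rightmost points of a nonempty compact subset of the real axis belong to it,
and bound the real parts. [folklore] -/
theorem extremes_mem {S : Set ℂ} (hS : IsCompact S) (hne : S.Nonempty) (him : ∀ x ∈ S, x.im = 0) :
    ((sInf (re '' S) : ℝ) : ℂ) ∈ S ∧ ((sSup (re '' S) : ℝ) : ℂ) ∈ S ∧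
      ∀ x ∈ S, sInf (re '' S) ≤ x.re ∧ x.re ≤ sSup (re '' S) := by
  have hc : IsCompact (re '' S) := hS.image Complex.continuous_re
  have hne' : (re '' S).Nonempty := hne.image _
  have hreal : ∀ x ∈ S, ((x.re : ℝ) : ℂ) = x := fun x hx ↦
    Complex.ext (by simp) (by simp [him x hx])
  refine ⟨?_, ?_, fun x hx ↦ ⟨csInf_le hc.bddBelow ⟨x, hx, rfl⟩, le_csSup hc.bddAbove ⟨x, hx, rfl⟩⟩⟩
  · obtain ⟨x, hx, hxe⟩ := hc.sInf_mem hne'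
    rw [← hxe, hreal x hx]; exact hx
  · obtain ⟨x, hx, hxe⟩ := hc.sSup_mem hne'
    rw [← hxe, hreal x hx]; exact hx

omit hf hinj hr₀ in
/-- `{ζ ∈ ℍ : |ζ| > M}` (`M ≥ 0`) is preconnected: it is the image of `(M, ∞) × (0, π)` under
polar coordinates. [folklore] -/
theorem isPreconnected_outer {M : ℝ} (hM : 0 ≤ M) :
    IsPreconnected {ζ : ℂ | ζ ∈ upperHalfPlaneSet ∧ M < ‖ζ‖} := by
  have heq : {ζ : ℂ | ζ ∈ upperHalfPlaneSet ∧ M < ‖ζ‖} =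
      (fun p : ℝ × ℝ ↦ circleMap ((0 : ℝ) : ℂ) p.1 p.2) '' (Ioi M ×ˢ Ioo 0 π) := by
    ext ζ
    constructor
    · rintro ⟨hζ, hMζ⟩
      have him : 0 < ζ.im := hζ
      obtain ⟨θ, hθ, hθeq⟩ := exists_circleMap_eq (c := 0) (u := ‖ζ‖) him (by simp)
      exact ⟨(‖ζ‖, θ), ⟨hMζ, hθ⟩, hθeq⟩
    · rintro ⟨⟨r, θ⟩, ⟨hr, hθ⟩, rfl⟩
      have hr0 : 0 < r := hM.trans_lt hr
      refine ⟨circleMap_mem_upperHalfPlaneSet 0 hr0 hθ, ?_⟩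
      show M < ‖circleMap ((0 : ℝ) : ℂ) r θ‖
      rw [Complex.ofReal_zero, norm_circleMap_zero, abs_of_pos hr0]
      exact hr
  rw [heq]
  refine (isPreconnected_Ioi.prod isPreconnected_Ioo).image _ ?_
  exact (AnnulusCrossing.continuous_circleMap_uncurry _).continuousOn

omit hf hinj hr₀ in
/-- **A bounded pocket lies within the extent of the tip component**: if `V(r)` is bounded,
nonempty, and the pocket `W(r)` of `q` is bounded, then `|w| ≤ sup_{V(r)} |·|` for every `w ∈ W(r)`.
[folklore] -/
theorem norm_le_sSup_of_mem_pocket {r : ℝ} {q : ℂ} (hVbdd : Bornology.IsBounded (tipComp f z rstar r))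
    (hVne : (tipComp f z rstar r).Nonempty) (hWbdd : Bornology.IsBounded (pocket f z rstar r q))
    {w : ℂ} (hw : w ∈ pocket f z rstar r q) : ‖w‖ ≤ sSup (norm '' tipComp f z rstar r) := by
  set M : ℝ := sSup (norm '' tipComp f z rstar r) with hM
  have hbdd : BddAbove (norm '' tipComp f z rstar r) := by
    obtain ⟨R, hR⟩ := (Metric.isBounded_iff_subset_closedBall 0).1 hVbdd
    refine ⟨R, ?_⟩
    rintro _ ⟨v, hv, rfl⟩
    have := hR hv
    rwa [mem_closedBall, dist_zero_right] at this
  have hM0 : 0 ≤ M := by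
    obtain ⟨v, hv⟩ := hVne
    exact (norm_nonneg v).trans (le_csSup hbdd ⟨v, hv, rfl⟩)
  by_contra hcon
  rw [not_le] at hcon
  -- the outer region is preconnected, misses `closure V`, contains `w`, hence lies in `W`
  set U : Set ℂ := {ζ : ℂ | ζ ∈ upperHalfPlaneSet ∧ M < ‖ζ‖} with hU
  have hUconn : IsPreconnected U := isPreconnected_outer hM0
  have hclV : closure (tipComp f z rstar r) ⊆ closedBall 0 M := by
    refine closure_minimal ?_ isClosed_closedBall
    intro v hv
    rw [mem_closedBall, dist_zero_right]
    exact le_csSup hbdd ⟨v, hv, rfl⟩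
  have hUsub : U ⊆ upperHalfPlaneSet \ closure (tipComp f z rstar r) := by
    rintro ζ ⟨hζ, hMζ⟩
    refine ⟨hζ, fun h ↦ ?_⟩
    have := hclV h
    rw [mem_closedBall, dist_zero_right] at this
    linarith
  have hwU : w ∈ U := ⟨pocket_subset r q hw, hcon⟩
  have hUW : U ⊆ pocket f z rstar r q := by
    have h1 : U ⊆ connectedComponentIn (upperHalfPlaneSet \ closure (tipComp f z rstar r)) w :=
      hUconn.subset_connectedComponentIn hwU hUsub
    rwa [← connectedComponentIn_eq hw] at h1
  -- but `U` is unbounded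
  obtain ⟨R, hR⟩ := (Metric.isBounded_iff_subset_closedBall 0).1 hWbdd
  set ρ : ℝ := max M R + 1 with hρ
  have hρmem : ((ρ : ℝ) : ℂ) * I ∈ U := by
    refine ⟨?_, ?_⟩
    · show 0 < (((ρ : ℝ) : ℂ) * I).im
      simp; rw [hρ]; linarith [le_max_left M R]
    · rw [norm_mul, Complex.norm_real, Complex.norm_I, mul_one, Real.norm_eq_abs, abs_of_pos
        (by rw [hρ]; linarith [le_max_left M R])]
      rw [hρ]; linarith [le_max_left M R]
  have := hR (hUW hρmem)
  rw [mem_closedBall, dist_zero_right, norm_mul, Complex.norm_real, Complex.norm_I, mul_one,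
    Real.norm_eq_abs, abs_of_pos (by rw [hρ]; linarith [le_max_left M R])] at this
  rw [hρ] at this
  linarith [le_max_right M R]

/-! ### The main estimate -/

include hf hinj hr₀ in
/-- **The nested-pocket estimate.** Under the setup of this file (half-disc `{|ζ| < r⋆} ∩ ℍ`
mapped into `B(z, r₀)`, `V(r₀)` bounded), let `T ⊆ ℍ` be preconnected, with a real point in its
closure, mapped outside `B̄(z, r₀ 4^K)` (`K ≥ 2`), and such that the pocket `W(r₀)` of a point
`q ∈ T` is bounded. Then for every `t ∈ T`: `T ⊆ B̄(t, 4 e^{2C₁} q₁^{K-2} |t|)`,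
`q₁ = (e^{C₁}-1)/(e^{C₁}+1)`.
[cite: LawlerWerness2010, Lemma 4.10 with Lemmas 4.4–4.5] [cite: Beffara2008, Lemma 8 (i)] -/
theorem subset_closedBall_of_nested (hrstar : 0 < rstar)
    (h0 : ∀ ζ ∈ upperHalfPlaneSet, ‖ζ‖ < rstar → ‖f ζ - z‖ < r₀)
    (hVbdd : Bornology.IsBounded (tipComp f z rstar (level r₀ 0)))
    {K : ℕ} (hK : 2 ≤ K) {T : Set ℂ} (hTconn : IsPreconnected T)
    (hTH : T ⊆ upperHalfPlaneSet) (hTreal : (closure T ∩ {x : ℂ | x.im = 0}).Nonempty)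
    (hTfar : ∀ t ∈ T, level r₀ K < ‖f t - z‖) {q : ℂ} (hq : q ∈ T)
    (hWbdd : Bornology.IsBounded (pocket f z rstar (level r₀ 0) q)) :
    ∀ t ∈ T, T ⊆ closedBall t (4 * Real.exp logConst ^ 2 *
      ((Real.exp logConst - 1) / (Real.exp logConst + 1)) ^ (K - 2) * ‖t‖) := by
  -- notation
  set E : ℝ := Real.exp logConst with hE
  have hE1 : 1 < E := by rw [hE]; exact Real.one_lt_exp_iff.2 logConst_pos  -- `e^{C₁} > 1`
  set q₁ : ℝ := (E - 1) / (E + 1) with hq₁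
  have hq₁0 : 0 ≤ q₁ := by rw [hq₁]; exact div_nonneg (by linarith) (by linarith)
  set W : ℕ → Set ℂ := fun k ↦ pocket f z rstar (level r₀ k) q with hWdef
  set V : ℕ → Set ℂ := fun k ↦ tipComp f z rstar (level r₀ k) with hVdef
  set F : ℕ → Set ℂ := fun k ↦ feet f z rstar (level r₀ k) q with hFdef
  -- `T ⊆ W k` for `k ≤ K`
  have hTW : ∀ k ≤ K, T ⊆ W k := by
    intro k hk
    refine subset_pocket_of_isPreconnected hTconn hTH ?_ hq
    rw [disjoint_left]
    intro t ht hcl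
    have h1 := norm_sub_le_of_mem_closure_tipComp hf (hTH ht) hcl
    have h2 := hTfar t ht
    have h3 : level r₀ k ≤ level r₀ K := level_mono hr₀.le hk
    linarith
  have hWanti : ∀ {k k' : ℕ}, k ≤ k' → W k' ⊆ W k := fun h ↦ pocket_anti (level_mono hr₀.le h) q
  have hWbdd' : ∀ k, Bornology.IsBounded (W k) := fun k ↦ hWbdd.subset (hWanti (Nat.zero_le k))
  have hWH : ∀ k, W k ⊆ upperHalfPlaneSet := fun k ↦ pocket_subset _ q
  have hWconn : ∀ k, IsPreconnected (W k) := fun k ↦ isPreconnected_pocket _ q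
  -- the feet: compact, nonempty for `k ≤ K`, decreasing
  have hFcpt : ∀ k, IsCompact (F k) := fun k ↦
    (Metric.isCompact_of_isClosed_isBounded isClosed_closure (hWbdd' k).closure).inter_right
      (isClosed_eq Complex.continuous_im continuous_const)
  have hFim : ∀ k, ∀ x ∈ F k, x.im = 0 := fun k x hx ↦ hx.2
  have hFne : ∀ k ≤ K, (F k).Nonempty := by
    intro k hk
    obtain ⟨x, hx, hxim⟩ := hTreal
    exact ⟨x, closure_mono (hTW k hk) hx, hxim⟩
  have hFanti : ∀ {k k' : ℕ}, k ≤ k' → F k' ⊆ F k := fun h ↦ feet_anti (level_mono hr₀.le h) q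
  have hFcl : ∀ k, F k ⊆ closure (W k) := fun k x hx ↦ hx.1
  -- extreme feet `A k ≤ B k`
  set A : ℕ → ℝ := fun k ↦ sInf (re '' F k) with hAdef
  set B : ℕ → ℝ := fun k ↦ sSup (re '' F k) with hBdef
  have hAB : ∀ k ≤ K, ((A k : ℝ) : ℂ) ∈ F k ∧ ((B k : ℝ) : ℂ) ∈ F k ∧
      ∀ x ∈ F k, A k ≤ x.re ∧ x.re ≤ B k := fun k hk ↦ extremes_mem (hFcpt k) (hFne k hk) (hFim k)
  have hAleB : ∀ k ≤ K, A k ≤ B k := fun k hk ↦ by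
    have := ((hAB k hk).2.2 _ (hAB k hk).1).2
    simpa using this
  have hAmono : ∀ k, k + 1 ≤ K → A k ≤ A (k + 1) := fun k hk ↦ by
    have hmem : ((A (k + 1) : ℝ) : ℂ) ∈ F k := hFanti (Nat.le_succ k) (hAB (k + 1) hk).1
    have := ((hAB k ((Nat.le_succ k).trans hk)).2.2 _ hmem).1
    simpa using this
  have hBmono : ∀ k, k + 1 ≤ K → B (k + 1) ≤ B k := fun k hk ↦ by
    have hmem : ((B (k + 1) : ℝ) : ℂ) ∈ F k := hFanti (Nat.le_succ k) (hAB (k + 1) hk).2.1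
    have := ((hAB k ((Nat.le_succ k).trans hk)).2.2 _ hmem).2
    simpa using this
  -- real points beyond the extreme feet are not in the closure of the pocket
  have hnotcl_right : ∀ k ≤ K, ∀ x : ℝ, B k < x → ((x : ℝ) : ℂ) ∉ closure (W k) := by
    intro k hk x hx hcl
    have hmem : ((x : ℝ) : ℂ) ∈ F k := ⟨hcl, by simp⟩
    have := ((hAB k hk).2.2 _ hmem).2
    simp at this
    linarith
  have hnotcl_left : ∀ k ≤ K, ∀ x : ℝ, x < A k → ((x : ℝ) : ℂ) ∉ closure (W k) := by
    intro k hk x hx hcl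
    have hmem : ((x : ℝ) : ℂ) ∈ F k := ⟨hcl, by simp⟩
    have := ((hAB k hk).2.2 _ hmem).1
    simp at this
    linarith
  -- the end points of the semicircle of radius `u` about `c`
  have hend0 : ∀ c u : ℝ, circleMap (c : ℂ) u 0 = (((c + u : ℝ)) : ℂ) := fun c u ↦ by
    simp [circleMap]
  have hendπ : ∀ c u : ℝ, circleMap (c : ℂ) u π = (((c - u : ℝ)) : ℂ) := fun c u ↦ by
    simp [circleMap, Complex.exp_pi_mul_I]
    ring
  -- distances between real points, as complex numbers
  have hdist : ∀ x y : ℝ, dist ((x : ℝ) : ℂ) ((y : ℝ) : ℂ) = |x - y| := fun x y ↦ by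
    rw [dist_eq_norm, ← Complex.ofReal_sub, Complex.norm_real, Real.norm_eq_abs]
  ------------------------------------------------------------------
  -- (I1) right feet: `B k - B (k+1) ≥ s (k+1) / (E - 1)`
  ------------------------------------------------------------------
  have hI1r : ∀ k, k + 1 ≤ K → (B (k + 1) - A (k + 1)) ≤ (E - 1) * (B k - B (k + 1)) := by
    intro k hk
    have hk' : k ≤ K := (Nat.le_succ k).trans hk
    set d : ℝ := B k - B (k + 1) with hd
    have hd0 : 0 ≤ d := by have := hBmono k hk; rw [hd]; linarith
    have hle : d + (B (k + 1) - A (k + 1)) ≤ E * d := by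
      refine ratio_le (z := z) (rstar := rstar) hf hinj hr₀ (k := k) (q := q) (c := B k) hd0 fun u hu ↦ ?_
      -- a point of `W (k+1)` on the semicircle
      have hWpt : ∃ θ ∈ Ioo (0 : ℝ) π, circleMap ((B k : ℝ) : ℂ) u θ ∈ W (k + 1) := by
        refine exists_circleMap_mem_of_closure (hWconn (k + 1)) (hWH (k + 1))
          (a := ((B (k + 1) : ℝ) : ℂ)) (b := ((A (k + 1) : ℝ) : ℂ))
          (hFcl (k + 1) (hAB (k + 1) hk).2.1) (hFcl (k + 1) (hAB (k + 1) hk).1) ?_ ?_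
        · rw [hdist, abs_sub_comm, abs_of_nonneg (by linarith [hBmono k hk])]
          linarith [hu.1]
        · rw [hdist, abs_sub_comm, abs_of_nonneg (by linarith [hAleB (k + 1) hk, hBmono k hk])]
          linarith [hu.2]
      obtain ⟨θW, hθW, hWmem⟩ := hWpt
      have hu0 : 0 < u := hd0.trans_lt hu.1
      -- a point of `closure V k` on the semicircle (the right end point is outside `closure W k`)
      obtain ⟨θV, hθV, hVmem⟩ := exists_mem_closure_tipComp_of_endpoint
        (level_mono hr₀.le (Nat.le_succ k)) hu0 hθW hWmem (e := 0) (Or.inl rfl) (by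
          rw [hend0]
          exact hnotcl_right k hk' _ (by linarith))
      exact ⟨θW, hθW, θV, hθV, hWmem, hVmem⟩
    nlinarith
  ------------------------------------------------------------------
  -- (I1') left feet: `A (k+1) - A k ≥ s (k+1) / (E - 1)`
  ------------------------------------------------------------------
  have hI1l : ∀ k, k + 1 ≤ K → (B (k + 1) - A (k + 1)) ≤ (E - 1) * (A (k + 1) - A k) := by
    intro k hk
    have hk' : k ≤ K := (Nat.le_succ k).trans hk
    set d : ℝ := A (k + 1) - A k with hd
    have hd0 : 0 ≤ d := by have := hAmono k hk; rw [hd]; linarith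
    have hle : d + (B (k + 1) - A (k + 1)) ≤ E * d := by
      refine ratio_le (z := z) (rstar := rstar) hf hinj hr₀ (k := k) (q := q) (c := A k) hd0 fun u hu ↦ ?_
      have hWpt : ∃ θ ∈ Ioo (0 : ℝ) π, circleMap ((A k : ℝ) : ℂ) u θ ∈ W (k + 1) := by
        refine exists_circleMap_mem_of_closure (hWconn (k + 1)) (hWH (k + 1))
          (a := ((A (k + 1) : ℝ) : ℂ)) (b := ((B (k + 1) : ℝ) : ℂ))
          (hFcl (k + 1) (hAB (k + 1) hk).1) (hFcl (k + 1) (hAB (k + 1) hk).2.1) ?_ ?_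
        · rw [hdist, abs_of_nonneg (by linarith [hAmono k hk])]
          linarith [hu.1]
        · rw [hdist, abs_of_nonneg (by linarith [hAleB (k + 1) hk, hAmono k hk])]
          linarith [hu.2]
      obtain ⟨θW, hθW, hWmem⟩ := hWpt
      have hu0 : 0 < u := hd0.trans_lt hu.1
      obtain ⟨θV, hθV, hVmem⟩ := exists_mem_closure_tipComp_of_endpoint
        (level_mono hr₀.le (Nat.le_succ k)) hu0 hθW hWmem (e := π) (Or.inr rfl) (by
          rw [hendπ]
          exact hnotcl_left k hk' _ (by linarith))
      exact ⟨θW, hθW, θV, hθV, hWmem, hVmem⟩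
    nlinarith
  -- hence the geometric decay of the spans `s k = B k - A k`
  have hdecay : ∀ k, k + 1 ≤ K → (B (k + 1) - A (k + 1)) ≤ q₁ * (B k - A k) := by
    intro k hk
    have h1 := hI1r k hk
    have h2 := hI1l k hk
    have hs : B k - A k = (A (k + 1) - A k) + (B (k + 1) - A (k + 1)) + (B k - B (k + 1)) := by ring
    rw [hq₁, div_mul_eq_mul_div, le_div_iff₀ (by linarith)]
    nlinarith
  ------------------------------------------------------------------
  -- (I2) the extent of `W (k+1)` from its left foot: `dist w (A (k+1)) ≤ E (A (k+1) - A k) ≤ E s k`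
  ------------------------------------------------------------------
  have hI2 : ∀ k, k + 1 ≤ K → ∀ w ∈ W (k + 1), dist w ((A (k + 1) : ℝ) : ℂ) ≤ E * (B k - A k) := by
    intro k hk w hw
    have hk' : k ≤ K := (Nat.le_succ k).trans hk
    set d : ℝ := A (k + 1) - A k with hd
    have hd0 : 0 ≤ d := by have := hAmono k hk; rw [hd]; linarith
    have hle : dist w ((A (k + 1) : ℝ) : ℂ) ≤ E * d := by
      refine ratio_le (z := z) (rstar := rstar) hf hinj hr₀ (k := k) (q := q) (c := A (k + 1)) hd0 fun u hu ↦ ?_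
      have hWpt : ∃ θ ∈ Ioo (0 : ℝ) π, circleMap ((A (k + 1) : ℝ) : ℂ) u θ ∈ W (k + 1) := by
        refine exists_circleMap_mem_of_closure_left (hWconn (k + 1)) (hWH (k + 1))
          (a := ((A (k + 1) : ℝ) : ℂ)) (b := w) (hFcl (k + 1) (hAB (k + 1) hk).1) hw ?_ hu.2
        rw [dist_self]
        exact hd0.trans_lt hu.1
      obtain ⟨θW, hθW, hWmem⟩ := hWpt
      have hu0 : 0 < u := hd0.trans_lt hu.1
      obtain ⟨θV, hθV, hVmem⟩ := exists_mem_closure_tipComp_of_endpoint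
        (level_mono hr₀.le (Nat.le_succ k)) hu0 hθW hWmem (e := π) (Or.inr rfl) (by
          rw [hendπ]
          exact hnotcl_left k hk' _ (by rw [hd] at hu; linarith [hu.1]))
      exact ⟨θW, hθW, θV, hθV, hWmem, hVmem⟩
    have hds : d ≤ B k - A k := by
      rw [hd]; linarith [hAleB (k + 1) hk, hBmono k hk]
    calc dist w ((A (k + 1) : ℝ) : ℂ) ≤ E * d := hle
      _ ≤ E * (B k - A k) := by gcongr
  ------------------------------------------------------------------
  -- (I3) the base: `‖w‖ ≤ E · dist (0, W 1)` for `w ∈ W 1`, hence `s 1 ≤ 2 E dist(0, W 1)`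
  ------------------------------------------------------------------
  have h1K : 1 ≤ K := le_trans (by norm_num) hK
  have hV0conn : IsPreconnected (V 0) := isPreconnected_connectedComponentIn
  have hV0H : V 0 ⊆ upperHalfPlaneSet := fun x hx ↦ (connectedComponentIn_subset _ _ hx).1
  have hV0ne : (V 0).Nonempty := ⟨basePoint rstar, halfDisc_subset_tipComp hrstar h0
    (le_of_eq level_zero.symm) ⟨(basePoint_mem hrstar).1, by
      rw [mem_ball, dist_zero_right]; exact (basePoint_mem hrstar).2⟩⟩
  have hV0cl : (0 : ℂ) ∈ closure (V 0) := zero_mem_closure_tipComp hrstar h0 (le_of_eq level_zero.symm)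
  have hVbddA : BddAbove (norm '' V 0) := by
    obtain ⟨R, hR⟩ := (Metric.isBounded_iff_subset_closedBall 0).1 hVbdd
    refine ⟨R, ?_⟩
    rintro _ ⟨v, hv, rfl⟩
    have := hR hv
    rwa [mem_closedBall, dist_zero_right] at this
  set β : ℝ := infDist (0 : ℂ) (W 1) with hβ
  have hβ0 : 0 ≤ β := infDist_nonneg
  have hI3 : ∀ w ∈ W 1, ‖w‖ ≤ E * β := by
    intro w hw
    have hwM : ‖w‖ ≤ sSup (norm '' V 0) :=
      norm_le_sSup_of_mem_pocket hVbdd hV0ne hWbdd (hWanti (Nat.zero_le 1) hw)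
    have hle : ‖w‖ ≤ E * β := by
      refine ratio_le (z := z) (rstar := rstar) hf hinj hr₀ (k := 0) (q := q) (c := 0) hβ0 fun u hu ↦ ?_
      -- a point of `W 1` on the semicircle about `0`
      have hWpt : ∃ θ ∈ Ioo (0 : ℝ) π, circleMap ((0 : ℝ) : ℂ) u θ ∈ W 1 := by
        have hlt : infDist (0 : ℂ) (W 1) < u := hu.1
        obtain ⟨a, ha, hau⟩ := (infDist_lt_iff ⟨w, hw⟩).1 hlt
        refine exists_circleMap_mem (hWconn 1) (hWH 1) ha hw ?_ ?_
        · rwa [Complex.ofReal_zero, dist_comm]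
        · rw [Complex.ofReal_zero, dist_zero_right]; exact hu.2
      obtain ⟨θW, hθW, hWmem⟩ := hWpt
      -- a point of `V 0` on the semicircle about `0`
      have hVpt : ∃ θ ∈ Ioo (0 : ℝ) π, circleMap ((0 : ℝ) : ℂ) u θ ∈ V 0 := by
        have hlt : u < sSup (norm '' V 0) := hu.2.trans_le hwM
        obtain ⟨_, ⟨b, hb, rfl⟩, hub⟩ := exists_lt_of_lt_csSup (hV0ne.image _) hlt
        refine exists_circleMap_mem_of_closure_left hV0conn hV0H hV0cl hb ?_ ?_
        · rw [Complex.ofReal_zero, dist_self]; exact hβ0.trans_lt hu.1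
        · rwa [Complex.ofReal_zero, dist_zero_right]
      obtain ⟨θV, hθV, hVmem⟩ := hVpt
      exact ⟨θW, hθW, θV, hθV, hWmem, subset_closure hVmem⟩
    exact hle
  have hW1sub : closure (W 1) ⊆ closedBall (0 : ℂ) (E * β) := by
    refine closure_minimal (fun w hw ↦ ?_) isClosed_closedBall
    rw [mem_closedBall, dist_zero_right]
    exact hI3 w hw
  have hs1 : B 1 - A 1 ≤ 2 * (E * β) := by
    have hA1 : |A 1| ≤ E * β := by
      have := hW1sub (hFcl 1 (hAB 1 h1K).1)
      rwa [mem_closedBall, dist_zero_right, Complex.norm_real, Real.norm_eq_abs] at this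
    have hB1 : |B 1| ≤ E * β := by
      have := hW1sub (hFcl 1 (hAB 1 h1K).2.1)
      rwa [mem_closedBall, dist_zero_right, Complex.norm_real, Real.norm_eq_abs] at this
    linarith [le_abs_self (B 1), neg_abs_le (A 1)]
  ------------------------------------------------------------------
  -- (I4) assembly
  ------------------------------------------------------------------
  -- the spans decay geometrically: `s (1 + j) ≤ q₁^j s 1` for `1 + j + 1 ≤ K`
  have hspan : ∀ j, 1 + j + 1 ≤ K → B (1 + j) - A (1 + j) ≤ q₁ ^ j * (B 1 - A 1) := by
    intro j
    induction j with
    | zero => intro _; simp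
    | succ j ih =>
      intro hj
      have h1 := hdecay (1 + j) (by omega)
      have h2 := ih (by omega)
      rw [show 1 + (j + 1) = 1 + j + 1 by ring, pow_succ]
      calc B (1 + j + 1) - A (1 + j + 1) ≤ q₁ * (B (1 + j) - A (1 + j)) := h1
        _ ≤ q₁ * (q₁ ^ j * (B 1 - A 1)) := mul_le_mul_of_nonneg_left h2 hq₁0
        _ = q₁ ^ j * q₁ * (B 1 - A 1) := by ring
  intro t ht t' ht'
  have htW1 : t ∈ W 1 := hTW 1 h1K ht
  have hβt : β ≤ ‖t‖ := by
    have := infDist_le_dist_of_mem (x := (0 : ℂ)) htW1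
    rwa [dist_comm, dist_zero_right] at this
  have htK : t ∈ W K := hTW K le_rfl ht
  have ht'K : t' ∈ W K := hTW K le_rfl ht'
  -- `K = (K-2) + 1 + 1`
  obtain ⟨k, rfl⟩ : ∃ k, K = k + 2 := ⟨K - 2, by omega⟩
  have hdd : dist t' t ≤ 2 * (E * (B (k + 1) - A (k + 1))) := by
    have h1 := hI2 (k + 1) le_rfl t' ht'K
    have h2 := hI2 (k + 1) le_rfl t htK
    calc dist t' t ≤ dist t' ((A (k + 1 + 1) : ℝ) : ℂ) + dist t ((A (k + 1 + 1) : ℝ) : ℂ) :=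
          dist_triangle_right _ _ _
      _ ≤ E * (B (k + 1) - A (k + 1)) + E * (B (k + 1) - A (k + 1)) := add_le_add h1 h2
      _ = 2 * (E * (B (k + 1) - A (k + 1))) := by ring
  have hsp : B (k + 1) - A (k + 1) ≤ q₁ ^ k * (B 1 - A 1) := by
    have := hspan k (by omega)
    rwa [show 1 + k = k + 1 by ring] at this
  rw [mem_closedBall]
  have hEpos : 0 < E := by linarith
  have hpow : 0 ≤ q₁ ^ k := pow_nonneg hq₁0 k
  simp only [Nat.add_sub_cancel]
  calc dist t' t ≤ 2 * (E * (B (k + 1) - A (k + 1))) := hdd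
    _ ≤ 2 * (E * (q₁ ^ k * (B 1 - A 1))) := by gcongr
    _ ≤ 2 * (E * (q₁ ^ k * (2 * (E * β)))) := by gcongr
    _ ≤ 2 * (E * (q₁ ^ k * (2 * (E * ‖t‖)))) := by gcongr
    _ = 4 * E ^ 2 * q₁ ^ k * ‖t‖ := by ring

end Main

end NestedPocket

end Literature.Analysis.Complex

end
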